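import Summits.AnomalousDissipation.AnomalousDissipation.Theorems.MarginalStabilityChainBurgersLayerKHLine

/-! # Stub `stub_modeOfZero` (line Sketch)

A slow mode with vanishing sheet coefficient is an eigenmode of the crux: the equation times `α·Re`
(algebra), decay at `+∞` from the normalisation `e^{αy}ψ → 1`, decay at `−∞` from `a = 0` via the
first-order factorisation `χ = ψ' + αψ`, `ξ = ψ' − αψ` of `ψ'' − α²ψ = −ω`, which gives
`2αψ(y) = e^{αy}∫_{t>y} e^{−αt}ω + e^{−αy}∫_{t≤y} e^{αt}ω`. -/

set_option linter.dupNamespace false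

noncomputable section

open Complex MeasureTheory Filter Topology Set Metric intervalIntegral

namespace Summit.AnomalousDissipation.AnomalousDissipation.Theorems.BurgersLayerKH.Sheet.ModeZero

/-! ## §0 Tails and primitives of integrable functions on `ℝ` -/

section Tails

variable {E' : Type*} [NormedAddCommGroup E'] [NormedSpace ℝ E'] [CompleteSpace E']

omit [CompleteSpace E'] in
/-- For an integrable `f`, `∫_{(-∞, y]} f → ∫_ℝ f` as `y → +∞`. [folklore] -/
theorem tendsto_integral_Iic_atTop {f : ℝ → E'} (hf : Integrable f) :
    Tendsto (fun y : ℝ => ∫ t in Iic y, f t) atTop (𝓝 (∫ t, f t)) := by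
  have h := tendsto_setIntegral_of_monotone (μ := volume) (f := f) (s := fun y : ℝ => Iic y)
    (fun _ => measurableSet_Iic) (fun _ _ hab => Iic_subset_Iic.2 hab)
    (by rw [iUnion_Iic]; exact hf.integrableOn)
  rwa [iUnion_Iic, setIntegral_univ] at h

omit [CompleteSpace E'] in
/-- For an integrable `f`, `∫_{(-∞, y]} f → 0` as `y → -∞`. [folklore] -/
theorem tendsto_integral_Iic_atBot {f : ℝ → E'} (hf : Integrable f) :
    Tendsto (fun y : ℝ => ∫ t in Iic y, f t) atBot (𝓝 0) := by
  have h := tendsto_setIntegral_of_antitone (μ := volume) (f := f) (s := fun y : ℝ => Iic (-y))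
    (fun _ => measurableSet_Iic) (fun _ _ hab => Iic_subset_Iic.2 (neg_le_neg hab))
    ⟨0, hf.integrableOn⟩
  have he : (⋂ y : ℝ, Iic (-y)) = ∅ := by
    ext x
    simp only [mem_iInter, mem_Iic, mem_empty_iff_false, iff_false, not_forall, not_le]
    exact ⟨1 - x, by linarith⟩
  rw [he, Measure.restrict_empty, integral_zero_measure] at h
  refine (h.comp tendsto_neg_atBot_atTop).congr fun y => ?_
  simp

omit [CompleteSpace E'] in
/-- For an integrable `f`, `∫_{(y, ∞)} f → 0` as `y → +∞`. [folklore] -/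
theorem tendsto_integral_Ioi_atTop {f : ℝ → E'} (hf : Integrable f) :
    Tendsto (fun y : ℝ => ∫ t in Ioi y, f t) atTop (𝓝 0) := by
  have h := (tendsto_integral_Iic_atTop hf).const_sub (∫ t, f t)
  rw [sub_self] at h
  refine h.congr fun y => ?_
  rw [← integral_Iic_add_Ioi (b := y) hf.integrableOn hf.integrableOn]
  abel

/-- The primitive `y ↦ ∫_{(-∞, y]} f` of a continuous integrable `f` has derivative `f`.
[folklore] -/
theorem hasDerivAt_integral_Iic {f : ℝ → E'} (hc : Continuous f) (hf : Integrable f) (y : ℝ) :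
    HasDerivAt (fun x : ℝ => ∫ t in Iic x, f t) (f y) y := by
  -- adapted from Cruxes/BurgersLayerKH/Disproof.lean (`green_sup_bound`)
  have e : (fun x : ℝ => ∫ t in Iic x, f t)
      = fun x => (∫ t in Iic 0, f t) + ∫ t in (0:ℝ)..x, f t := by
    funext x
    rw [← integral_Iic_sub_Iic hf.integrableOn hf.integrableOn]
    abel
  rw [e]
  exact ((hc.integral_hasStrictDerivAt 0 y).hasDerivAt).const_add _

end Tails

/-! ## §1 Exponential tilts of Gaussian-class functions -/

/-- An exponential tilt `e^{a u} ω(u)` of a continuous Gaussian-class `ω` is integrable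
(`a u − u²/4 ≤ 2a² − u²/8`). [folklore] -/
theorem integrable_exp_mul {ω : ℝ → ℂ} (hω : Continuous ω) {C : ℝ} (hG : GaussBound ω C)
    (a : ℝ) : Integrable fun u : ℝ => ((Real.exp (a * u) : ℝ) : ℂ) * ω u := by
  -- adapted from Cruxes/BurgersLayerKH/Disproof.lean (`exp_tilt_le`)
  have hC0 : 0 ≤ C := by
    have h := hG 0
    norm_num at h
    exact (norm_nonneg _).trans h
  have iGauss : Integrable fun u : ℝ => C * Real.exp (2 * a ^ 2) * Real.exp (-(1 / 8) * u ^ 2) :=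
    (integrable_exp_neg_mul_sq (by norm_num : (0:ℝ) < 1 / 8)).const_mul _
  refine iGauss.mono' (Continuous.aestronglyMeasurable (by fun_prop))
    (Eventually.of_forall fun u => ?_)
  rw [norm_mul, Complex.norm_of_nonneg (Real.exp_pos _).le]
  calc Real.exp (a * u) * ‖ω u‖ ≤ Real.exp (a * u) * (C * Real.exp (-(u ^ 2) / 4)) :=
        mul_le_mul_of_nonneg_left (hG u) (Real.exp_pos _).le
    _ = C * Real.exp (a * u + -(u ^ 2) / 4) := by rw [Real.exp_add]; ring
    _ ≤ C * Real.exp (2 * a ^ 2 + -(1 / 8) * u ^ 2) :=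
        mul_le_mul_of_nonneg_left (Real.exp_le_exp.2 (by nlinarith [sq_nonneg (u - 4 * a)])) hC0
    _ = C * Real.exp (2 * a ^ 2) * Real.exp (-(1 / 8) * u ^ 2) := by rw [Real.exp_add]; ring

/-! ## §2 The first-order factorisation and the decay of a slow mode with `a = 0` -/

/-- **Decay of a normalised mode with vanishing sheet coefficient.** Let `α > 0`, `ψ ∈ C²` with
`ψ'' = α²ψ − ω`, `ω` continuous of Gaussian class, `e^{αy}ψ(y) → 1` at `+∞` and
`∫ e^{αt}ω(t) dt = 2α`. Then `ψ ≢ 0` and `ψ → 0` at `±∞`: with `χ = ψ' + αψ`, `ξ = ψ' − αψ`,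
`e^{−αy}χ + ∫_{t≤y} e^{−αt}ω` and `e^{αy}ξ + ∫_{t≤y} e^{αt}ω` are first integrals, the
normalisation kills the free constant of `χ` and the sheet condition that of `ξ`, whence
`2αψ(y) = e^{αy}∫_{t>y} e^{−αt}ω + e^{−αy}∫_{t≤y} e^{αt}ω → 0` at `−∞`. [folklore] -/
theorem decay_of_sheet {α : ℝ} (hα : 0 < α) {ψ ω : ℝ → ℂ} {C : ℝ}
    (hψ : ∀ y, HasDerivAt ψ (deriv ψ y) y)
    (hψ' : ∀ y, HasDerivAt (deriv ψ) ((α : ℂ) ^ 2 * ψ y - ω y) y)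
    (hωc : Continuous ω) (hG : GaussBound ω C)
    (hlim : Tendsto (fun y : ℝ => (Real.exp (α * y) : ℂ) * ψ y) atTop (𝓝 1))
    (hint : ∫ t : ℝ, (Real.exp (α * t) : ℂ) * ω t = 2 * α) :
    (∃ y, ψ y ≠ 0) ∧ Tendsto ψ atTop (𝓝 0) ∧ Tendsto ψ atBot (𝓝 0) := by
  -- adapted from Cruxes/BurgersLayerKH/Disproof.lean (`green_sup_bound`,
  -- `psi_eq_zero_of_vorticity_eq_zero`)
  -- the exponentials `E = e^{αy}`, `F = e^{-αy}`
  set E : ℝ → ℂ := fun y => ((Real.exp (α * y) : ℝ) : ℂ) with hE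
  set F : ℝ → ℂ := fun y => ((Real.exp (-(α * y)) : ℝ) : ℂ) with hF
  have hEd : ∀ y, HasDerivAt E ((α : ℂ) * E y) y := by
    intro y
    have h1 : HasDerivAt (fun s : ℝ => Real.exp (α * s)) (Real.exp (α * y) * α) y := by
      simpa using ((hasDerivAt_id y).const_mul α).exp
    have := h1.ofReal_comp
    simp only [hE]
    convert this using 1
    push_cast; ring
  have hFd : ∀ y, HasDerivAt F (-(α : ℂ) * F y) y := by
    intro y
    have h1 : HasDerivAt (fun s : ℝ => Real.exp (-(α * s))) (Real.exp (-(α * y)) * (-α)) y := by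
      simpa using (((hasDerivAt_id y).const_mul α).neg).exp
    have := h1.ofReal_comp
    simp only [hF]
    convert this using 1
    push_cast; ring
  have hEF : ∀ y, E y * F y = 1 := by
    intro y; simp only [hE, hF]; rw [← ofReal_mul, ← Real.exp_add]; simp
  have nE : ∀ y, ‖E y‖ = Real.exp (α * y) := fun y => Complex.norm_of_nonneg (Real.exp_pos _).le
  have nF : ∀ y, ‖F y‖ = Real.exp (-(α * y)) := fun y =>
    Complex.norm_of_nonneg (Real.exp_pos _).le
  have hFtop : Tendsto F atTop (𝓝 0) := by
    rw [tendsto_zero_iff_norm_tendsto_zero]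
    simp only [nF]
    exact Real.tendsto_exp_atBot.comp (tendsto_neg_atTop_atBot.comp (tendsto_id.const_mul_atTop hα))
  have hEbot : Tendsto (fun y => Real.exp (α * y)) atBot (𝓝 0) :=
    Real.tendsto_exp_atBot.comp (tendsto_id.const_mul_atBot hα)
  -- (1) non-triviality and decay at `+∞` from the normalisation
  have hne : ∃ y, ψ y ≠ 0 := by
    obtain ⟨y, hy⟩ := (hlim.eventually_ne one_ne_zero).exists
    exact ⟨y, right_ne_zero_of_mul hy⟩
  have htop : Tendsto ψ atTop (𝓝 0) := by
    have h := hFtop.mul hlim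
    rw [zero_mul] at h
    refine h.congr fun y => ?_
    show F y * (E y * ψ y) = ψ y
    rw [← mul_assoc, mul_comm (F y), hEF, one_mul]
  refine ⟨hne, htop, ?_⟩
  -- (2) the tilts `gp = e^{αu}ω`, `gm = e^{-αu}ω` and their primitives
  set gp : ℝ → ℂ := fun u => E u * ω u with hgp
  set gm : ℝ → ℂ := fun u => F u * ω u with hgm
  have igp : Integrable gp := integrable_exp_mul hωc hG α
  have igm : Integrable gm := by
    have := integrable_exp_mul hωc hG (-α)
    simpa [hgm, hF, neg_mul] using this
  have iω : Integrable ω := by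
    have := integrable_exp_mul hωc hG 0
    simpa using this
  have cgp : Continuous gp := by
    show Continuous fun u => ((Real.exp (α * u) : ℝ) : ℂ) * ω u
    fun_prop
  have cgm : Continuous gm := by
    show Continuous fun u => ((Real.exp (-(α * u)) : ℝ) : ℂ) * ω u
    fun_prop
  set Bp : ℝ → ℂ := fun y => ∫ u in Iic y, gp u with hBp
  set Bm : ℝ → ℂ := fun y => ∫ u in Iic y, gm u with hBm
  have hBpd : ∀ y, HasDerivAt Bp (gp y) y := hasDerivAt_integral_Iic cgp igp
  have hBmd : ∀ y, HasDerivAt Bm (gm y) y := hasDerivAt_integral_Iic cgm igm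
  -- (3) the factorisation: `F·(ψ' + αψ) + Bm` and `E·(ψ' − αψ) + Bp` are first integrals
  set χ : ℝ → ℂ := fun y => deriv ψ y + (α : ℂ) * ψ y with hχ
  set ξ : ℝ → ℂ := fun y => deriv ψ y - (α : ℂ) * ψ y with hξ
  have hχd : ∀ y, HasDerivAt χ ((α : ℂ) * χ y - ω y) y := fun y =>
    ((hψ' y).fun_add ((hψ y).const_mul (α : ℂ))).congr_deriv (by simp only [hχ]; ring)
  have hξd : ∀ y, HasDerivAt ξ (-(α : ℂ) * ξ y - ω y) y := fun y =>
    ((hψ' y).fun_sub ((hψ y).const_mul (α : ℂ))).congr_deriv (by simp only [hξ]; ring)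
  have hP : ∀ y, HasDerivAt (fun x => F x * χ x + Bm x) 0 y := fun y =>
    (((hFd y).fun_mul (hχd y)).fun_add (hBmd y)).congr_deriv (by simp only [hgm]; ring)
  have hQ : ∀ y, HasDerivAt (fun x => E x * ξ x + Bp x) 0 y := fun y =>
    (((hEd y).fun_mul (hξd y)).fun_add (hBpd y)).congr_deriv (by simp only [hgp]; ring)
  set K : ℂ := F 0 * χ 0 + Bm 0 with hK
  set K' : ℂ := E 0 * ξ 0 + Bp 0 with hK'
  have hPc : ∀ y, F y * χ y + Bm y = K := fun y =>
    is_const_of_deriv_eq_zero (fun x => (hP x).differentiableAt) (fun x => (hP x).deriv) y 0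
  have hQc : ∀ y, E y * ξ y + Bp y = K' := fun y =>
    is_const_of_deriv_eq_zero (fun x => (hQ x).differentiableAt) (fun x => (hQ x).deriv) y 0
  have hrep : ∀ y, 2 * (α : ℂ) * ψ y = E y * (K - Bm y) - F y * (K' - Bp y) := by
    intro y
    have h1 := hPc y
    have h2 := hQc y
    simp only [hχ, hξ] at h1 h2
    linear_combination E y * h1 - F y * h2 - 2 * (α : ℂ) * ψ y * hEF y
  -- (4) limits at `+∞`: `Bp → ∫ gp = 2α`, `Bm → ∫ gm`, and `E²(K − Bm) → K'`
  have hBp2 : Tendsto Bp atTop (𝓝 (2 * α)) := by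
    have e : ∫ u, gp u = 2 * α := hint
    have := tendsto_integral_Iic_atTop igp
    rwa [e] at this
  have hBmT : Tendsto Bm atTop (𝓝 (∫ u, gm u)) := tendsto_integral_Iic_atTop igm
  have hT : Tendsto (fun y => E y ^ 2 * (K - Bm y)) atTop (𝓝 K') := by
    have h1 : Tendsto (fun y => 2 * (α : ℂ) * (E y * ψ y) + K' - Bp y) atTop
        (𝓝 (2 * (α : ℂ) * 1 + K' - 2 * α)) := ((hlim.const_mul _).add_const K').sub hBp2
    rw [show 2 * (α : ℂ) * 1 + K' - 2 * α = K' by ring] at h1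
    refine h1.congr fun y => ?_
    linear_combination E y * hrep y - (K' - Bp y) * hEF y
  -- hence the free constant of `χ` vanishes: `K = ∫ gm`, `K - Bm y = ∫_{u>y} gm`
  have hK0 : K = ∫ u, gm u := by
    have h1 : Tendsto (fun y => K - Bm y) atTop (𝓝 (K - ∫ u, gm u)) :=
      tendsto_const_nhds.sub hBmT
    have h2 : Tendsto (fun y => K - Bm y) atTop (𝓝 0) := by
      have h3 := (hFtop.pow 2).mul hT
      rw [show (0 : ℂ) ^ 2 * K' = 0 by ring] at h3
      refine h3.congr fun y => ?_
      linear_combination (K - Bm y) * (E y * F y + 1) * hEF y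
    exact sub_eq_zero.1 (tendsto_nhds_unique h1 h2)
  have hKBm : ∀ y, K - Bm y = ∫ u in Ioi y, gm u := by
    intro y
    rw [hK0]
    have := integral_Iic_add_Ioi (b := y) igm.integrableOn igm.integrableOn
    simp only [hBm]
    linear_combination -this
  -- and the free constant of `ξ` vanishes: `K' = 0` (`E²(K − Bm) → 0` by the tail of `∫ ‖gp‖`)
  have hK'0 : K' = 0 := by
    refine tendsto_nhds_unique hT
      (squeeze_zero_norm (fun y => ?_) (tendsto_integral_Ioi_atTop igp.norm))
    show ‖E y ^ 2 * (K - Bm y)‖ ≤ ∫ u in Ioi y, ‖gp u‖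
    rw [hKBm y, norm_mul, norm_pow, nE]
    have h2 : Real.exp (α * y) ^ 2 * ∫ u in Ioi y, ‖gm u‖
        = ∫ u in Ioi y, Real.exp (α * y) ^ 2 * ‖gm u‖ := (MeasureTheory.integral_const_mul _ _).symm
    have h3 : ∫ u in Ioi y, Real.exp (α * y) ^ 2 * ‖gm u‖ ≤ ∫ u in Ioi y, ‖gp u‖ := by
      refine setIntegral_mono_on ((igm.norm.const_mul _).integrableOn) igp.norm.integrableOn
        measurableSet_Ioi fun u hu => ?_
      simp only [hgm, hgp, norm_mul, nE, nF]
      have e : Real.exp (α * y) ^ 2 * Real.exp (-(α * u)) = Real.exp (2 * (α * y) - α * u) := by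
        rw [sq, ← Real.exp_add, ← Real.exp_add]
        congr 1
        ring
      rw [← mul_assoc, e]
      refine mul_le_mul_of_nonneg_right (Real.exp_le_exp.2 ?_) (norm_nonneg _)
      have := mul_le_mul_of_nonneg_left (le_of_lt (mem_Ioi.1 hu)) hα.le
      linarith
    calc Real.exp (α * y) ^ 2 * ‖∫ u in Ioi y, gm u‖
        ≤ Real.exp (α * y) ^ 2 * ∫ u in Ioi y, ‖gm u‖ := by
          gcongr
          exact MeasureTheory.norm_integral_le_integral_norm _
      _ ≤ ∫ u in Ioi y, ‖gp u‖ := h2.le.trans h3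
  -- (5) the representation `2αψ = E·∫_{u>y} gm + F·Bp` and the decay at `−∞`
  have hfin : ∀ y, 2 * (α : ℂ) * ψ y = E y * (∫ u in Ioi y, gm u) + F y * Bp y := by
    intro y
    rw [hrep y, hKBm y, hK'0]
    ring
  have hbd : ∀ y, ‖ψ y‖ ≤ (Real.exp (α * y) * (∫ u, ‖gm u‖) + ∫ u in Iic y, ‖ω u‖) / (2 * α) := by
    intro y
    rw [le_div_iff₀ (by positivity)]
    have e1 : ‖ψ y‖ * (2 * α) = ‖2 * (α : ℂ) * ψ y‖ := by
      simp only [norm_mul, Complex.norm_of_nonneg hα.le, Complex.norm_ofNat]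
      ring
    rw [e1, hfin y]
    have h1 : ‖E y * ∫ u in Ioi y, gm u‖ ≤ Real.exp (α * y) * ∫ u, ‖gm u‖ := by
      rw [norm_mul, nE]
      gcongr
      exact (MeasureTheory.norm_integral_le_integral_norm _).trans
        (setIntegral_le_integral igm.norm (Eventually.of_forall fun u => norm_nonneg _))
    have h2 : ‖F y * Bp y‖ ≤ ∫ u in Iic y, ‖ω u‖ := by
      rw [norm_mul, nF]
      have h3 : ‖Bp y‖ ≤ ∫ u in Iic y, ‖gp u‖ := MeasureTheory.norm_integral_le_integral_norm _
      have h4 : ∫ u in Iic y, ‖gp u‖ ≤ ∫ u in Iic y, Real.exp (α * y) * ‖ω u‖ := by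
        refine setIntegral_mono_on igp.norm.integrableOn ((iω.norm.const_mul _).integrableOn)
          measurableSet_Iic fun u hu => ?_
        simp only [hgp, norm_mul, nE]
        exact mul_le_mul_of_nonneg_right
          (Real.exp_le_exp.2 (mul_le_mul_of_nonneg_left (mem_Iic.1 hu) hα.le)) (norm_nonneg _)
      have h5 : ∫ u in Iic y, Real.exp (α * y) * ‖ω u‖ = Real.exp (α * y) * ∫ u in Iic y, ‖ω u‖ :=
        MeasureTheory.integral_const_mul _ _
      calc Real.exp (-(α * y)) * ‖Bp y‖
          ≤ Real.exp (-(α * y)) * (Real.exp (α * y) * ∫ u in Iic y, ‖ω u‖) :=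
            mul_le_mul_of_nonneg_left (h3.trans (h4.trans h5.le)) (Real.exp_pos _).le
        _ = ∫ u in Iic y, ‖ω u‖ := by rw [← mul_assoc, ← Real.exp_add]; simp
    exact (norm_add_le _ _).trans (add_le_add h1 h2)
  refine squeeze_zero_norm hbd ?_
  have h := ((hEbot.mul_const (∫ u, ‖gm u‖)).add (tendsto_integral_Iic_atBot iω.norm)).div_const
    (2 * α)
  simpa using h

/-! ## §3 The registered stub -/

/-- **A slow mode with vanishing sheet coefficient is an eigenmode of the crux** at Reynolds
number `Re`, `h = 1/(α Re)`, `σ = λ·α·Re`: the equation multiplied by `α·Re`, `ψ ≢ 0` and decay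
at `+∞` from the normalisation `e^{αy}ψ → 1`, decay at `−∞` from `a = 0` (`decay_of_sheet`).
[folklore] -/
theorem stub_modeOfZero : ∀ α Re : ℝ, ModeOfZero α Re := by
  intro α Re hα hRe lam ψ hmode ha
  obtain ⟨hC4, heq, ⟨C, hG⟩, hlim, -⟩ := hmode
  dsimp only
  have hαC : (α : ℂ) ≠ 0 := ofReal_ne_zero.2 hα.ne'
  -- derivatives of `ψ` and continuity of `ω = vort α ψ`
  have hd : Differentiable ℝ ψ := hC4.differentiable (by norm_num)
  have hd1 : Differentiable ℝ (deriv ψ) := by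
    have := hC4.differentiable_iteratedDeriv 1 (by norm_num)
    simpa [iteratedDeriv_one] using this
  have h2 : ∀ y, deriv (deriv ψ) y = iteratedDeriv 2 ψ y := fun y => by
    rw [iteratedDeriv_succ, iteratedDeriv_one]
  have hψ' : ∀ y, HasDerivAt (deriv ψ) ((α : ℂ) ^ 2 * ψ y - vort α ψ y) y := fun y => by
    have := (hd1 y).hasDerivAt
    rw [h2 y] at this
    exact this.congr_deriv (by simp only [vort]; ring)
  have hωc : Continuous (vort α ψ) := by
    have h3 := hC4.continuous_iteratedDeriv 2 (by norm_num)
    have h4 := hC4.continuous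
    show Continuous fun y => -(iteratedDeriv 2 ψ y - (α : ℂ) ^ 2 * ψ y)
    exact (h3.sub (continuous_const.mul h4)).neg
  -- the sheet condition `∫ e^{αt} ω = 2α`
  have hint : ∫ t : ℝ, (Real.exp (α * t) : ℂ) * vort α ψ t = 2 * α := by
    have h := ha
    unfold sheetCoeff at h
    have e : (2 * (α : ℂ)) * (1 - 1 / (2 * (α : ℂ)) * ∫ t : ℝ, (Real.exp (α * t) : ℂ) * vort α ψ t)
        = 2 * α - ∫ t : ℝ, (Real.exp (α * t) : ℂ) * vort α ψ t := by
      rw [mul_sub, mul_one, ← mul_assoc, mul_one_div_cancel (mul_ne_zero two_ne_zero hαC),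
        one_mul]
    rw [h, mul_zero] at e
    linear_combination e
  obtain ⟨hne, htop, hbot⟩ :=
    decay_of_sheet hα (fun y => (hd y).hasDerivAt) hψ' hωc hG hlim hint
  refine ⟨hC4, hne, htop, hbot, ⟨C, hG⟩, fun y => ?_⟩
  -- the equation times `α·Re`
  show lam * ((α * Re : ℝ) : ℂ) * vort α ψ y = -(Complex.I * α * Re) * ((U y : ℂ) * vort α ψ y
    + (Upp y : ℂ) * ψ y) + vort α ψ y + (y : ℂ) * deriv (vort α ψ) y
    + iteratedDeriv 2 (vort α ψ) y - (α : ℂ) ^ 2 * vort α ψ y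
  have h := heq y
  have h1 : ((1 / (α * Re) : ℝ) : ℂ) * ((α : ℂ) * Re) = 1 := by
    rw [← ofReal_mul, ← ofReal_mul, one_div_mul_cancel (mul_pos hα hRe).ne', ofReal_one]
  simp only [ou] at h
  push_cast at h h1 ⊢
  linear_combination ((α : ℂ) * Re) * h +
    (iteratedDeriv 2 (vort α ψ) y + (y : ℂ) * deriv (vort α ψ) y
      + (1 - (α : ℂ) ^ 2) * vort α ψ y) * h1

end Summit.AnomalousDissipation.AnomalousDissipation.Theorems.BurgersLayerKH.Sheet.ModeZero

end
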